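import Mathlib.LinearAlgebra.FiniteDimensional.Defs
import Mathlib.LinearAlgebra.LinearIndependent.Lemmas
import Literature.RingTheory.GaloisAlgebras.SpeiserLemma
import HarnessLib

/-!
# Speiser descent, fixed-basis form: a semilinear representation of a finite group acting
# faithfully on a field has a basis of invariant vectors

R90-TF, section S6 (Rogawski Ch. 14.1–14.5, stable trace formula), WAVE 7 card **W7-g**
(DAG row E1.4.3.2.1 «Hilbert 90 for `GL_n`, field level (Speiser)»), helper lane for
`stmt-HodgeConjecture-24833`.

Let a finite group `Γ` act faithfully by ring automorphisms on a field `L` (for a finite Galois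
extension `L/K` take `Γ = L ≃ₐ[K] L` with Mathlib's `AlgEquiv.applyMulSemiringAction`,
`s • e = s e` by `AlgEquiv.smul_def`), and let `ρ` be an additive action of `Γ` on a
finite-dimensional `L`-vector space `V` which is **semilinear**, `ρ_s (e • v) = s(e) • ρ_s v`
(a "descent datum"). Then `V` has an `L`-basis consisting of `ρ`-FIXED vectors
(`exists_basis_forall_fixed_of_semilinear`). Equivalently the fixed vectors `V^Γ` form an
`L^Γ`-form of `V`; in cocycle language this is `H¹(Γ, GL_n(L)) = 1` (Serre, *Local Fields*, Ch. X,
§1, Prop. 3), delivered in matrix form in `R90S6HilbertNinetyGLn`.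

Proof: by the tree's Speiser lemma (Cartier's argument,
`Literature.RingTheory.GaloisAlgebras.span_fixedPoints_eq_top`) the fixed vectors span `V` over
`L`; a spanning set of a vector space contains a basis (Mathlib `exists_linearIndependent`,
`Module.Basis.mk`), re-indexed by `Fin (finrank L V)` through `Module.Basis.indexEquiv`.
No hypothesis on the characteristic, on `|Γ|` being invertible, or on `L/L^Γ` is needed beyond
the finiteness of `Γ`.

Dedup record (R90 bus, S6 WAVE 7, R90-C14-p08 (g0)): the ISOMORPHISM form
`L ⊗[K] V^Γ ≃ₗ[L] V` is already ★ in the tree as `Literature.FieldTheory.Galois.descentEquiv`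
(KMRT (18.1), types in `Type`); Mathlib (2026-07) has only the case `n = 1`
(`groupCohomology.isMulCoboundary₁_of_isMulCocycle₁_of_aut_to_units`). This file adds the
fixed-basis form, universe-polymorphic and for an arbitrary finite `Γ`.

## References
* J.-P. Serre, *Local Fields*, GTM 67 (1979), Ch. X, §1, Prop. 3 (and Speiser 1919).
* M.-A. Knus, A. Merkurjev, M. Rost, J.-P. Tignol, *The Book of Involutions* (1998), Lemma (18.1).
-/

set_option autoImplicit false
set_option linter.dupNamespace false

namespace Summit.HodgeConjecture.HodgeConjecture.R90.S6

/-- **Speiser descent, fixed-basis form.** Let the finite group `Γ` act faithfully by ring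
automorphisms on the field `L`, and additively and semilinearly (`ρ_s (e • v) = s(e) • ρ_s v`) on
the finite-dimensional `L`-vector space `V`. Then `V` admits an `L`-basis, indexed by
`Fin (finrank L V)`, all of whose vectors are fixed by every `ρ_s`. (The fixed vectors span `V`
by Speiser's lemma `Literature.RingTheory.GaloisAlgebras.span_fixedPoints_eq_top`; a spanning
set contains a basis.) For `Γ = L ≃ₐ[K] L`, `L/K` finite Galois, this says that every
semilinear Galois descent datum on `V` is split: `V = L ⊗_K V^Γ` with `V^Γ` the `K`-span of the
basis (Serre, *Local Fields*, Ch. X, §1, Prop. 3: `H¹(G, GL_n(L)) = 1`). -/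
theorem exists_basis_forall_fixed_of_semilinear {Γ L V : Type*} [Group Γ] [Fintype Γ] [Field L]
    [MulSemiringAction Γ L] [FaithfulSMul Γ L] [AddCommGroup V] [Module L V] [Module.Finite L V]
    (ρ : Γ →* AddMonoid.End V) (hρ : ∀ (s : Γ) (e : L) (v : V), ρ s (e • v) = (s • e) • ρ s v) :
    ∃ b : Module.Basis (Fin (Module.finrank L V)) L V, ∀ i s, ρ s (b i) = b i := by
  -- the fixed vectors span `V` (Speiser), so they contain a linearly independent spanning subset
  obtain ⟨t, htS, hspan, hli⟩ :=
    exists_linearIndependent L {w : V | ∀ s : Γ, ρ s w = w}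
  have hsp : ⊤ ≤ Submodule.span L (Set.range ((↑) : t → V)) := by
    rw [Subtype.range_coe, hspan, Literature.RingTheory.GaloisAlgebras.span_fixedPoints_eq_top ρ hρ]
  -- that subset is a basis; re-index it by `Fin (finrank L V)`
  let b₀ : Module.Basis t L V := Module.Basis.mk hli hsp
  let e : t ≃ Fin (Module.finrank L V) := b₀.indexEquiv (Module.finBasis L V)
  refine ⟨b₀.reindex e, fun i s => ?_⟩
  rw [Module.Basis.reindex_apply, Module.Basis.mk_apply]
  exact htS (e.symm i).2 s

end Summit.HodgeConjecture.HodgeConjecture.R90.S6
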